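import Literature.NumberTheory.EllipticCurves.Tian2014.CMPointSystemSignedSums
import HarnessLib

/-!
# Monsky 1990 Thm. 5.5 and Thm. 5.9 (1) transplanted onto Tian's CM points: `y_{2n} ∉ 2E(K)⁻ + E[2]` on `𝒮⁻`
# (M-y), modulo the DISPLAYED Monsky inputs (Lemma 4.1, Thm. 4.7's ambiguous class, the genus facts, Lemma 5.4 /
# Lemma 5.8) — ONE named fact `monskyTwoDescentDisplays_sMinus`

Cell `bsd-monsky` (typer seat), kernel work K1, last step. `E(H)[2] = {O,(0,0),(±1,0)}`; transfer images are fixed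
/ negated by `Gal(H/ℚ)` according to `θ ↦ ±θ`; the transversal `G² ∪ J·G²` of Thm. 5.5's proof; and ONE theorem
(`CMPointData.minusY_of_twoDescentLemma`) for both printed proofs (Thm. 5.5, `n ≡ 7 (8)`, second twist `d = n`,
Lemma 5.4; Thm. 5.9 (1), `n ≡ 3 (8)`, `(p₅/p₇) = −1`, second twist `d = p₇`, Lemma 5.8): with `R = Σ_{G²} z_t`,
`y_{d,φ} + y_{2n,φ} = 2R`, `R^σ − R = ε`, `R^τ − R = (0,0)` (`|G²|` odd), and `y_{2n} = 2S + t` would give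
`P = R − S` with `2P` rational over `ℚ(√−d)`, `P^σ − P = ε`, `P^τ − P = (0,0)` — excluded by the descent lemma.
The Monsky inputs are packaged AS PRINTED (through `φ : C ≅ E`) in `monskyTwoDescentDisplays_sMinus`; K1 is then
`minusY_of_monskyDisplays`. Nothing asserted.
[cite: Monsky1990MockHeegner, Thm. 5.5 and Lemma 5.4 (p. 62), Thm. 5.9 (1) and Lemma 5.8 (pp. 63–64), Thm. 4.7 (pp. 57–58), Lemma 4.1 (p. 56), Remarks (2) (p. 62)]
-/

noncomputable section

open scoped Classical

open WeierstrassCurve NumberField Literature.NumberTheory.EllipticCurves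
  Literature.NumberTheory.EllipticCurves.TianYuanZhang2017 Literature.GroupTheory.FiniteAbelian

namespace Literature.NumberTheory.EllipticCurves.Tian2014

/-! ## §K1.f Two more tools: the `2`-torsion of `E(H)` is rational, and transfer images are fixed by `Gal(H/ℚ(θ))` -/

section TwoTorsionClassification

variable {H : Type} [Field H] [CharZero H]

/-- **`E(H)[2] = {O, (0,0), (1,0), (−1,0)}`** for every field `H` of characteristic `0`: a `2`-torsion affine point has
`y = 0` and `x³ − x = 0`. (Monsky: "`T`, the `2`-division points" of `C`, all rational; Tian: `E[2]`.)
[cite: Monsky1990MockHeegner, p. 48 (T = C[2] = {(±1, ±1)}) and p. 62 Remarks (2)] -/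
theorem eq_zero_or_pt_of_two_nsmul_eq_zero (P : EPoint H) (hP : (2 : ℕ) • P = 0) :
    P = 0 ∨ P = ptZero ∨ P = ptOne ∨ P = ptNegOne := by
  rcases P with _ | ⟨x, y, h⟩
  · left; rfl
  · right
    have hy : y = 0 := by
      by_contra hy0
      have hne : y ≠ ((congruentNumberCurve 1).baseChange H).toAffine.negY x y := by
        rw [negY_baseChange_of_isCharNeTwoNF']
        intro e; apply hy0; linear_combination e / 2
      rw [two_nsmul, WeierstrassCurve.Affine.Point.add_self_of_Y_ne hne] at hP
      exact WeierstrassCurve.Affine.Point.some_ne_zero _ hP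
    subst hy
    have heq : (0 : H) ^ 2 = x ^ 3 - x := (E_nonsingular_iff x 0).mp h
    have hfac : x * ((x - 1) * (x + 1)) = 0 := by linear_combination -heq
    rcases mul_eq_zero.mp hfac with h0 | h1
    · left; subst h0; rfl
    · rcases mul_eq_zero.mp h1 with h1 | h1
      · right; left; rw [sub_eq_zero] at h1; subst h1; rfl
      · right; right; rw [add_eq_zero_iff_eq_neg] at h1; subst h1; rfl

end TwoTorsionClassification

section TransferFixed

variable {H : Type} [Field H] [CharZero H]

/-- Base-changed rational points are fixed by every `ℚ`-automorphism of `H`. [cite: Monsky1990MockHeegner, Def. 4.2 (p. 56)] -/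
theorem map_ιK_eq (W : WeierstrassCurve ℚ) (g : H ≃ₐ[ℚ] H) (P : W.toAffine.Point) :
    WeierstrassCurve.Affine.Point.map (W' := W) g.toAlgHom (W2.ιK W H P) = W2.ιK W H P := by
  rcases P with _ | ⟨x, y, h⟩
  · show WeierstrassCurve.Affine.Point.map (W' := W) g.toAlgHom (W2.ιK W H 0) = W2.ιK W H 0
    rw [map_zero, map_zero]
  · obtain ⟨h', hι⟩ := ιK_some (H := H) W h
    rw [hι, WeierstrassCurve.Affine.Point.map_some]
    simp only [WeierstrassCurve.Affine.Point.some.injEq]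
    exact ⟨AlgEquiv.commutes g x, AlgEquiv.commutes g y⟩

variable (N : ℕ)

/-- **Transfer images are fixed by every automorphism fixing `θ`** ("`Λ_N` consists of points rational over
`ℚ(i√N)`"): `g_*(transfer y′) = transfer y′` when `g θ = θ` (naturality of the untwisting isomorphism and
rationality of `y′`). [cite: Monsky1990MockHeegner, Def. 4.2 (p. 56)] -/
theorem act_transferE_of_fix (θ : H) (hθ2 : θ ^ 2 = algebraMap ℚ H (-(N : ℚ))) (hθ : θ ≠ 0)
    (g : H ≃ₐ[ℚ] H) (hg : g θ = θ) (y' : (congruentNumberCurve N).toAffine.Point) :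
    WeierstrassCurve.Affine.Point.map (W' := congruentNumberCurve 1) g.toAlgHom (transferE N θ hθ2 hθ y') =
      transferE N θ hθ2 hθ y' := by
  simp only [transferE, AddMonoidHom.comp_apply, AddEquiv.coe_toAddMonoidHom]
  rw [map_untwistEquivAt_of_eq (congruentNumberCurve 1) hθ2 hθ hθ2 hθ g.toAlgHom hg]
  congr 1
  exact map_ιK_eq _ g _

/-- **Transfer images are negated by every automorphism moving `θ`** ("transformed into their negatives by
complex conjugation"). [cite: Monsky1990MockHeegner, Def. 4.2 (p. 56)] -/
theorem act_transferE_of_neg (θ : H) (hθ2 : θ ^ 2 = algebraMap ℚ H (-(N : ℚ))) (hθ : θ ≠ 0)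
    (g : H ≃ₐ[ℚ] H) (hg : g θ = -θ) (y' : (congruentNumberCurve N).toAffine.Point) :
    WeierstrassCurve.Affine.Point.map (W' := congruentNumberCurve 1) g.toAlgHom (transferE N θ hθ2 hθ y') =
      -transferE N θ hθ2 hθ y' := by
  simp only [transferE, AddMonoidHom.comp_apply, AddEquiv.coe_toAddMonoidHom]
  rw [map_untwistEquivAt_of_eq_neg (congruentNumberCurve 1) hθ2 hθ hθ2 hθ g.toAlgHom hg]
  congr 2
  exact map_ιK_eq _ g _

end TransferFixed

namespace CMPointData

variable {n : ℕ}

/-! ## §K1.g Monsky Thm. 5.5 transplanted (case `n ≡ 7 (mod 8)`, i.e. `q ≡ 3 (mod 8)`): `y_{2n} ∉ 2E(K)⁻ + E[2]`,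
MODULO the displays «Lemma 5.4» and the genus-theory facts of `Cl(ℚ(√−2n))` as Monsky prints them -/

section FiveFive

variable (D : CMPointData n) {θ' : D.H}

/-- `χ` is trivial on squares. [cite: Monsky1990MockHeegner, Thm. 5.5 proof (p. 62: "⟨G², m⟩ = G_D")] -/
theorem chi_of_isSquare {c : ℚ} (hθ' : θ' ^ 2 = algebraMap ℚ D.H c) {t : ClassGroup (𝓞 (GenusField (2 * n)))}
    (ht : IsSquare t) : D.chi θ' t = 1 := by
  obtain ⟨r, rfl⟩ := ht
  rw [D.chi_mul hθ']
  rcases D.chi_eq_one_or_neg_one θ' r with h | h <;> rw [h] <;> norm_num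

/-- **The transversal `φ = G² ∪ J·G²` of `G/⟨m⟩`** (Monsky Thm. 5.5 proof: "`m ∉ G²` and `⟨G², m⟩ = G_D`. So if
`J ∈ G − G_D`, `φ = G² ∪ JG²` is a set of representatives for `G/⟨m⟩`"). [cite: Monsky1990MockHeegner, Thm. 5.5 proof (p. 62)] -/
theorem isRepsModPiPrime_sq_union {c : ℚ} (hθ' : θ' ^ 2 = algebraMap ℚ D.H c) (hπθ' : D.art D.piPrime θ' = θ')
    (hGD : ∀ t : ClassGroup (𝓞 (GenusField (2 * n))), D.chi θ' t = 1 ↔ (IsSquare t ∨ IsSquare (D.piPrime * t)))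
    (hπsq : ¬ IsSquare D.piPrime) {J : ClassGroup (𝓞 (GenusField (2 * n)))} (hJ : D.chi θ' J = -1) :
    D.IsRepsModPiPrime ((Finset.univ.filter IsSquare) ∪
      (Finset.univ.filter IsSquare).image (fun t => J * t)) := by
  classical
  have hmem : ∀ t, t ∈ (Finset.univ.filter IsSquare) ∪ (Finset.univ.filter IsSquare).image (fun t => J * t) ↔
      (IsSquare t ∨ IsSquare (J⁻¹ * t)) := by
    intro t
    simp only [Finset.mem_union, Finset.mem_filter, Finset.mem_image, Finset.mem_univ, true_and]
    constructor
    · rintro (h | ⟨u, hu, rfl⟩)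
      · exact Or.inl h
      · right; rwa [inv_mul_cancel_left]
    · rintro (h | h)
      · exact Or.inl h
      · exact Or.inr ⟨J⁻¹ * t, h, by rw [mul_inv_cancel_left]⟩
  have hπJ : D.chi θ' (D.piPrime * J) = -1 := by
    rw [D.chi_mul hθ']
    have : D.chi θ' D.piPrime = 1 := by unfold chi; rw [hπθ']; simp
    rw [this, hJ, one_mul]
  have hJinv : D.chi θ' J⁻¹ = -1 := by rw [D.chi_inv hθ', hJ]
  -- the four exclusions
  have exAC : ∀ t, IsSquare t → IsSquare (D.piPrime * t) → False := by
    intro t hA hC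
    apply hπsq
    have := hC.mul hA.inv
    rwa [mul_inv_cancel_right] at this
  have exAD : ∀ t, IsSquare t → IsSquare (J⁻¹ * (D.piPrime * t)) → False := by
    intro t hA hD
    have h1 := D.chi_of_isSquare hθ' (hD.mul hA.inv)
    have : D.chi θ' D.piPrime = 1 := by unfold chi; rw [hπθ']; simp
    rw [mul_assoc, mul_inv_cancel_right, D.chi_mul hθ', hJinv, this] at h1
    norm_num at h1
  have exBC : ∀ t, IsSquare (J⁻¹ * t) → IsSquare (D.piPrime * t) → False := by
    intro t hB hC
    have h1 := D.chi_of_isSquare hθ' (hC.mul hB.inv)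
    rw [mul_inv, inv_inv, mul_mul_mul_comm, mul_inv_cancel, mul_one, hπJ] at h1
    norm_num at h1
  have exBD : ∀ t, IsSquare (J⁻¹ * t) → IsSquare (J⁻¹ * (D.piPrime * t)) → False := by
    intro t hB hD
    apply hπsq
    have := hD.mul hB.inv
    rwa [mul_inv, inv_inv, mul_mul_mul_comm, inv_mul_cancel, one_mul, mul_inv_cancel_right] at this
  intro t
  rw [hmem, hmem, show J⁻¹ * (D.piPrime * t) = J⁻¹ * (D.piPrime * t) from rfl]
  rcases D.chi_eq_one_or_neg_one θ' t with ht | ht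
  · rcases (hGD t).mp ht with hA | hC
    · exact Or.inl ⟨Or.inl hA, fun h => h.elim (exAC t hA) (exAD t hA)⟩
    · exact Or.inr ⟨Or.inl hC, fun h => h.elim (fun hA => exAC t hA hC) (fun hB => exBC t hB hC)⟩
  · have ht' : D.chi θ' (J⁻¹ * t) = 1 := by rw [D.chi_mul hθ', hJinv, ht]; norm_num
    rcases (hGD _).mp ht' with hB | hD
    · exact Or.inl ⟨Or.inr hB, fun h => h.elim (exBC t hB) (exBD t hB)⟩
    · rw [mul_left_comm] at hD
      exact Or.inr ⟨Or.inr hD, fun h => h.elim (fun hA => exAD t hA hD) (fun hB => exBD t hB hD)⟩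


/-- **Monsky Thm. 5.5 / Thm. 5.9 (1) transplanted onto Tian's points: `y_{2n} ∉ 2E(K)⁻ + E[2]`** — i.e. `D.MinusY`:
the Heegner point `y_{2n,φ}` (`φ = G² ∪ JG²`) is the transfer of a rational point `y₂` of `E_{2n}` which is NOT of
the form `2z + t`. The two printed proofs have ONE shape, with a second twist `d` (`d = n` and Lemma 5.4 for
`n ≡ 7 (8)`, case (13); `d = p₇` and Lemma 5.8 for `n = p₅p₇ ≡ 3 (8)`, `(p₅/p₇) = −1`, case (15)⁻): with
`R = Σ_{G²} z_t`, `y_{d,φ} + y_{2n,φ} = 2R`; `R^σ − R = Σ_{G²} ε = ε` and `R^τ − R = (0,0)` (`|G²|` odd; `ε = (1,0)`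
resp. `(−1,0)` = Thm. 2.8 (3)); if `y_{2n} = 2S + t` then `P := R − S` has `2P = y_{d,φ} + t` rational over
`ℚ(√−d)` (Thm. 4.7 for the second twist), `P^σ − P = ε`, `P^τ − P = (0,0)` — excluded by the descent lemma
(`h5x`: Lemma 5.4 says no `P` with `2P ∈ Λ_D`, `P^σ − P = (−1,1) ↦ (1,0)`, `P^τ − P = (−1,−1) ↦ (0,0)`; Lemma 5.8
says `2P ∈ Λ_{p₇} ⟹ P^σ − P ∈ {(1,1), (−1,−1)} ↦ {0, (0,0)}`, so `≠ (1,−1) ↦ (−1,0)`). INPUTS beyond `Printed`: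
(a) the descent lemma `h5x` (display), (b) the genus facts «`⟨G², m⟩ = G_N`» (`hGD`), «`m ∉ G²`» (`hπsq`),
«`G²` contains an odd number of classes» (`hodd`), «`J ∈ G − G_N`» (`hJ`), (c) `√−d ∈ H` fixed by `σ_m`
(Lemma 4.1) and `σ_{1+ϖ}`, negated by conjugation, (d) an ambiguous class `B ∉ {1, m}` (Thm. 4.7).
[cite: Monsky1990MockHeegner, Thm. 5.5 and its proof (p. 62), Lemma 5.4 (p. 62), Thm. 5.9 (1) and its proof (pp. 63–64), Lemma 5.8 (p. 63), Thm. 4.7 (pp. 57–58), Lemma 4.1 (p. 56)] -/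
theorem minusY_of_twoDescentLemma (hn : n ≠ 0) (hsq2n : Squarefree (2 * n)) (hP : D.Printed) (d : ℕ)
    (hd : d ≠ 0) (hθ'd : θ' ^ 2 = algebraMap ℚ D.H (-(d : ℚ))) (hθ'0 : θ' ≠ 0)
    (hπθ' : D.art D.piPrime θ' = θ') (hτθ' : D.tau θ' = θ') (hcθ' : D.conj θ' = -θ')
    {B : ClassGroup (𝓞 (GenusField (2 * n)))} (hB2 : B * B = 1) (hB1 : B ≠ 1) (hBπ : B ≠ D.piPrime)
    (hGD : ∀ t : ClassGroup (𝓞 (GenusField (2 * n))), D.chi θ' t = 1 ↔ (IsSquare t ∨ IsSquare (D.piPrime * t)))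
    (hπsq : ¬ IsSquare D.piPrime)
    (hodd : Odd (Finset.univ.filter (IsSquare : ClassGroup (𝓞 (GenusField (2 * n))) → Prop)).card)
    {J : ClassGroup (𝓞 (GenusField (2 * n)))} (hJ : D.chi θ' J = -1)
    (h5x : ∀ P : EPoint D.H, (∃ y', transferE d θ' hθ'd hθ'0 y' = (2 : ℕ) • P) →
      D.act (D.art D.piPrime) P - P = (if n % 8 = 7 then ptOne else ptNegOne) →
      D.act D.tau P - P = ptZero → False) :
    D.MinusY hn := by
  classical
  have hP' := hP
  obtain ⟨h1, -, h3, h48, hart, ⟨-, htauθ, -⟩, -, -, -, -, -⟩ := hP'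
  set sq := Finset.univ.filter (IsSquare : ClassGroup (𝓞 (GenusField (2 * n))) → Prop) with hsq
  set φ := sq ∪ sq.image (fun t => J * t) with hφdef
  have hφ : D.IsRepsModPiPrime φ := D.isRepsModPiPrime_sq_union hθ'd hπθ' hGD hπsq hJ
  obtain ⟨y₂, hy₂⟩ := D.exists_transfer_eq_yPoint hn hP hB2 hB1 hBπ hφ
  refine ⟨φ, hφ, y₂, hy₂, ?_⟩
  intro z t ht heq
  have ht2 : (2 : ℕ) • t = 0 := two_nsmul_eq_zero_of_isOfFinAddOrder_congruentNumberCurve hsq2n ht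
  -- `R := Σ_{G²} z_u`
  set R : EPoint D.H := ∑ u ∈ sq, D.z u with hR
  have hdisj : Disjoint sq (sq.image (fun t => J * t)) := by
    rw [Finset.disjoint_left]
    intro u hu hu'
    rw [Finset.mem_image] at hu'
    obtain ⟨v, hv, rfl⟩ := hu'
    rw [hsq, Finset.mem_filter] at hu hv
    have := D.chi_of_isSquare hθ'd (hu.2.mul hv.2.inv)
    rw [mul_inv_cancel_right, hJ] at this
    norm_num at this
  have hinjJ : Set.InjOn (fun t => J * t) ↑sq := fun a _ b _ hab => mul_left_cancel hab
  have hsum1 : D.yPoint φ = R + ∑ u ∈ sq, D.z (J * u) := by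
    rw [yPoint, hφdef, Finset.sum_union hdisj, Finset.sum_image hinjJ]
  have hsum2 : D.yPointChi θ' φ = R - ∑ u ∈ sq, D.z (J * u) := by
    rw [yPointChi, hφdef, Finset.sum_union hdisj, Finset.sum_image hinjJ, sub_eq_add_neg,
      ← Finset.sum_neg_distrib]
    congr 1
    · exact Finset.sum_congr rfl (fun u hu => by
        rw [D.chi_of_isSquare hθ'd ((Finset.mem_filter.mp hu).2), one_zsmul])
    · exact Finset.sum_congr rfl (fun u hu => by
        rw [D.chi_mul hθ'd, hJ, D.chi_of_isSquare hθ'd ((Finset.mem_filter.mp hu).2), mul_one, neg_one_zsmul])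
  have h2R : D.yPointChi θ' φ + D.yPoint φ = (2 : ℕ) • R := by
    rw [hsum1, hsum2, two_nsmul]; abel
  -- `R^σ − R = ε`, `R^τ − R = (0,0)` (`|G²|` odd)
  set ε : EPoint D.H := if n % 8 = 7 then ptOne else ptNegOne with hε
  have hε2 : (2 : ℕ) • ε = 0 := by
    rw [hε]; split_ifs
    · exact two_nsmul_ptOne
    · exact two_nsmul_ptNegOne
  have hsh : ∀ u, D.z (D.piPrime * u) = D.z u + ε := by
    intro u
    have := h3 u
    rw [sub_eq_iff_eq_add] at this
    rw [this, hε, add_comm]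
  have hRσ : D.act (D.art D.piPrime) R - R = ε := by
    have : D.act (D.art D.piPrime) R = R + ∑ _u ∈ sq, ε := by
      rw [hR, map_sum, ← Finset.sum_add_distrib]
      exact Finset.sum_congr rfl (fun u _ => by rw [h48, hsh u])
    rw [this, Finset.sum_const, odd_nsmul_of_two_nsmul_eq_zero hε2 hodd, add_sub_cancel_left]
  have hRτ : D.act D.tau R - R = ptZero := by
    have : D.act D.tau R = R + ∑ _u ∈ sq, (ptZero : EPoint D.H) := by
      rw [hR, map_sum, ← Finset.sum_add_distrib]
      exact Finset.sum_congr rfl (fun u _ => h1 u)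
    rw [this, Finset.sum_const, odd_nsmul_of_two_nsmul_eq_zero two_nsmul_ptZero hodd, add_sub_cancel_left]
  -- the hypothetical halving `y_{2n,φ} = 2S + T`
  set S : EPoint D.H := D.transfer hn z with hS
  set T : EPoint D.H := D.transfer hn t with hT
  have hyST : D.yPoint φ = (2 : ℕ) • S + T := by
    rw [← hy₂, heq, map_add, map_zsmul, two_zsmul, two_nsmul]
  have hT2 : (2 : ℕ) • T = 0 := by rw [hT, ← map_nsmul, ht2, map_zero]
  set P : EPoint D.H := R - S with hPdef
  -- `2P = y_{d,φ} + T` is rational over `ℚ(√−d)`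
  obtain ⟨yn, hyn⟩ := D.exists_transferE_eq_yPointChi hθ'0 hP d hd hθ'd hπθ' hτθ' hcθ' hB2 hB1 hBπ hφ
  have hTimg : ∃ t', transferE d θ' hθ'd hθ'0 t' = T := by
    rcases eq_zero_or_pt_of_two_nsmul_eq_zero T hT2 with h0 | h0 | h0 | h0
    · exact ⟨0, by rw [map_zero, h0]⟩
    · exact ⟨_, by rw [transferE_some_zero_zero d hd, h0]⟩
    · exact ⟨_, by rw [transferE_twoTorsionNegN d hd, h0]⟩
    · exact ⟨_, by rw [transferE_twoTorsionPosN d hd, h0]⟩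
  obtain ⟨t', ht'⟩ := hTimg
  have h2P : (2 : ℕ) • P = transferE d θ' hθ'd hθ'0 (yn + t') := by
    rw [map_add, hyn, ht', hPdef, smul_sub, ← h2R, hyST]; abel
  -- `P^σ − P = ε`, `P^τ − P = (0,0)`: `S` is fixed by `σ` and `τ` (rational over `K`)
  have hSσ : D.act (D.art D.piPrime) S = S := by
    rw [hS]; exact act_transferE_of_fix (2 * n) _ _ _ _ (hart D.piPrime).2 z
  have hSτ : D.act D.tau S = S := by
    rw [hS]; exact act_transferE_of_fix (2 * n) _ _ _ _ htauθ z
  have hPσ : D.act (D.art D.piPrime) P - P = ε := by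
    rw [hPdef, map_sub, hSσ, ← hRσ]; abel
  have hPτ : D.act D.tau P - P = ptZero := by
    rw [hPdef, map_sub, hSτ, ← hRτ]; abel
  exact h5x P ⟨yn + t', h2P.symm⟩ hPσ hPτ

end FiveFive

end CMPointData

/-! ## §K1.h The Monsky displays on `𝒮⁻` as ONE named fact, and K1 discharged modulo it -/

/-- Distinct odd primes `p ≠ q`: `2pq` is square-free. [cite: Monsky1990MockHeegner, p. 45 ("N square-free")] [folklore] -/
theorem squarefree_two_mul_mul_of_primes {p q : ℕ} (hp : p.Prime) (hq : q.Prime) (hp2 : p ≠ 2) (hq2 : q ≠ 2)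
    (hne : p ≠ q) : Squarefree (2 * (p * q)) := by
  have cop : ∀ {a b : ℕ}, a.Prime → b.Prime → a ≠ b → a.Coprime b :=
    fun ha hb hab => (Nat.coprime_primes ha hb).mpr hab
  refine Nat.squarefree_mul_iff.mpr ⟨?_, Nat.prime_two.prime.squarefree, ?_⟩
  · exact Nat.Coprime.mul_right (cop Nat.prime_two hp hp2.symm) (cop Nat.prime_two hq hq2.symm)
  · exact Nat.squarefree_mul_iff.mpr ⟨cop hp hq hne, hp.prime.squarefree, hq.prime.squarefree⟩

namespace CMPointData

variable {n : ℕ}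

/-- **THE MONSKY INPUTS ON A CM SYSTEM `D`, AS PRINTED** (a predicate on `D`; asserted for Tian's ACTUAL system only,
inside the one named fact below — faithfulness addendum of the lit seat, 2026-08-25): (c) a second twist `d` (`d = n`
if `n ≡ 7 (8)`, `d = p₇` if `n = p₅p₇ ≡ 3 (8)`) with `√−d ∈ H(i)` fixed by `σ_m` ("`i√N ∈ H` … `m ∈ G_N`", Lemma
4.1) and by `σ_{1+ϖ}` (trivial on `H`) and negated by complex conjugation; (d) an ambiguous class `B ∉ {1, m}`
("`B` is ambiguous, but is neither principal nor `m`", Thm. 4.7 proof); (b) the genus facts "`m ∉ G²` and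
`⟨G², m⟩ = G_N`", "genus theory shows that `G²` contains an odd number of classes" (Thm. 5.5 proof; Thm. 5.9 (1)
proof: "If `(p₅/p₇) = −1`, `G²` contains an odd number of classes"), "`J ∈ G − G_N`"; (a) the descent lemma:
Lemma 5.4 ("no `P ∈ C` with `2P ∈ Λ_D`, `P^σ − P = (−1,1)`, `P^τ − P = (−1,−1)`") for `n ≡ 7 (8)`, Lemma 5.8
("`2P ∈ Λ_{p₇}` ⟹ `P^σ − P ∈ {(1,1), (−1,−1)}`") for `n ≡ 3 (8)` — on `E` through `φ : C ≅ E` (`(−1,1), (1,−1),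
(−1,−1) ↦ (1,0), (−1,0), (0,0)`, p. 62 Remarks (2)), `Λ_N` = the image of the transfer along `√−N` (Lemma 4.3),
`σ = σ_m` fixing `i` (`art piPrime`), `τ = σ_{1+ϖ}`.
[cite: Monsky1990MockHeegner, Lemma 4.1 (p. 56), Thm. 4.7 proof (p. 57), Thm. 5.5 proof and Lemma 5.4 (p. 62), Thm. 5.9 (1) proof and Lemma 5.8 (pp. 63–64), Remarks (2) (p. 62)] -/
def MonskyDisplays (D : CMPointData n) : Prop :=
  ∃ (d : ℕ) (θ' : D.H) (_hd : d ≠ 0) (hθ'd : θ' ^ 2 = algebraMap ℚ D.H (-(d : ℚ))) (hθ'0 : θ' ≠ 0)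
    (B J : ClassGroup (𝓞 (GenusField (2 * n)))),
    D.art D.piPrime θ' = θ' ∧ D.tau θ' = θ' ∧ D.conj θ' = -θ' ∧
    B * B = 1 ∧ B ≠ 1 ∧ B ≠ D.piPrime ∧
    (∀ t, D.chi θ' t = 1 ↔ (IsSquare t ∨ IsSquare (D.piPrime * t))) ∧ ¬ IsSquare D.piPrime ∧
    Odd (Finset.univ.filter (IsSquare : ClassGroup (𝓞 (GenusField (2 * n))) → Prop)).card ∧
    D.chi θ' J = -1 ∧
    (∀ P : EPoint D.H, (∃ y', transferE d θ' hθ'd hθ'0 y' = (2 : ℕ) • P) →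
      D.act (D.art D.piPrime) P - P = (if n % 8 = 7 then ptOne else ptNegOne) →
      D.act D.tau P - P = ptZero → False)

/-- **K1 DISCHARGED on a system carrying the Monsky inputs**: `Printed ∧ MonskyDisplays ⟹ MinusY`.
[cite: Monsky1990MockHeegner, Thm. 5.14 (13)/(15) (p. 66)] -/
theorem minusY_of_monskyDisplays (D : CMPointData n) (hn : n ≠ 0) (hsq2n : Squarefree (2 * n)) (hP : D.Printed)
    (hM : D.MonskyDisplays) : D.MinusY hn := by
  obtain ⟨d, θ', hd, hθ'd, hθ'0, B, J, hπθ', hτθ', hcθ', hB2, hB1, hBπ, hGD, hπsq, hodd, hJ, h5x⟩ := hM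
  exact D.minusY_of_twoDescentLemma hn hsq2n hP d hd hθ'd hθ'0 hπθ' hτθ' hcθ' hB2 hB1 hBπ hGD hπsq hodd hJ h5x

end CMPointData

/-- **THE ONE NAMED FACT OF THE ENCLOSURE: Tian's CM-point system on `𝒮⁻` with ALL its printed properties.** For
`n = pq` (`p ≡ 5 (8)`, `q ≡ 3 (4)`, `(p/q) = −1`) there is a system `D : CMPointData (pq)` — Tian's actual data
`(H(i), 𝒜, σ_t, σ_{1+ϖ}, conj, z_t)` — satisfying (1) the displays of Tian Thm. 2.8 / (4.9)_J / Prop. 4.6's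
generation sentence (`Printed`), (2) the Gross–Zagier index relation `y_{2n} ≐ ±𝓛(1)𝓛(2n)·g`
(`GrossZagierScriptL`: TYZ Thm. 3.3 at `(2n, 1)` + Tian `P_{χ₀}(f) = 4y_{2n}` (p0027 L62–L64) + the (B4) assembly
`R_{χ₀} ≐ ±2y_{2n}` via Tian Prop. 2.1/2.2, TYZ Prop. 3.13 (1), Thm. 3.6 — PRINTED-GRADE MODULO THE ASSEMBLY, =
PROOF-A Lemma 8.1 + (9.1.2)), (3) the Monsky inputs (`MonskyDisplays`: Lemma 4.1, Thm. 4.7's ambiguous class, the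
genus facts, Lemma 5.4 / Lemma 5.8 through `φ : C ≅ E`). All three are statements about the SAME actual system
(lit faithfulness addendum: (a)/(c) are printed for the CM system `H(i)`, hence packaged here existentially, not
for an arbitrary system). ADMISSIBILITY: after the cross-family referee's PASS (PROOF-A §8–9 for (2)); no `_holds`
expected (CM points on `X₀(32)`, the Yuan–Zhang–Zhang formula, explicit `2`-descent over the genus field).
[cite: Tian2014, Def. 2.7, Thm. 2.8 (arXiv:1210.8231 p0011 L25–L44 = journal p. 132), (4.8) (p0023 L46–L50), p0027 L62–L64, Prop. 2.1–2.2 (J124–J126)]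
[cite: TianYuanZhang2017, Thm. 3.3 (chunk p0016 L48–L54), Prop. 3.13 (1), Thm. 3.6, Thm. 1.1 (n = 1)]
[cite: Monsky1990MockHeegner, Thm. 2.11 (p. 51), Lemma 4.1 (p. 56), Thm. 4.7 (pp. 57–58), Lemma 5.4 and Thm. 5.5 (p. 62), Lemma 5.8 and Thm. 5.9 (1) (pp. 63–64)] -/
def tian2014_monsky1990_system_sMinus : Prop :=
  ∀ p q : ℕ, (hp : p.Prime) → (hq : q.Prime) → p % 8 = 5 → q % 4 = 3 → jacobiSym p q = -1 →
    ∃ D : CMPointData (p * q), D.Printed ∧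
      D.GrossZagierScriptL (Nat.mul_ne_zero hp.ne_zero hq.ne_zero) ∧ D.MonskyDisplays

end Literature.NumberTheory.EllipticCurves.Tian2014

end
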